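import Summits.CriticalPhenomena.CardyFormulaZ2.Theorems.CardyComplexConeSLESixFamiliesGiveCardySmoothMarkFamiliesPart9
import Summits.CriticalPhenomena.CardyFormulaZ2.Theorems.CardySelfRefinementLagHandOffDiscretisableLabelling
import HarnessLib

/-!
# Smooth-mark discretisation families, part 10: the labelling package at a fixed mesh

Helper file for stub `stub_smoothMarkFamilies` of line `collar-touch-sandwich` of crux
`SLESixFamiliesGiveCardy` (stmt-CriticalPhenomena-9654).  From the abstract per-mesh hypotheses of
part 9 (label `A`, per-mark tests `C i`, cut edges `z i`) we derive, for
`SA = zdBoundary ∩ {A}`, `SB = zdBoundary ∩ {¬ A}`, the full conjunction required at mesh `δ` by the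
labelling reduction `zdDiscretisationFamily_of_labelling` (cover, disjointness, both labels occur, no
forcing either way, sides within `6δ`, exactly two crossing edges each bounding exactly one inner
face), together with the identification of the crossing edges and the `5δ`-closeness of their
midpoints to the marked points (`package_at_mesh`).
-/

noncomputable section

open Set Metric
open Literature.Probability Literature.Probability.RandomPlanarGeometry
  Literature.Probability.LatticeModels Literature.Probability.Percolation

namespace Summit.CriticalPhenomena.CardyFormulaZ2.Cruxes.SLESixFamiliesGiveCardy.CollarTouchSandwich

namespace SmoothMark

/-- Sides: a boundary site labelled by the Voronoi rule towards `arc j` is within `2δ` of it; a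
boundary site within `6δ` of a marked point is within `6δ` of both arcs. [folklore] -/
theorem infDist_arc_le_of_label (D : DobrushinDomain) {δ : ℝ} (hδ : 0 < δ) {x : Site 2}
    (hx : x ∈ (⟨D.carrier, δ, ∅, ∅⟩ : DiscreteDobrushin).zdBoundary) (j : Fin 2)
    (h : (∃ i : Fin 2, dist (meshPoint δ x) (D.pt i) < 6 * δ) ∨
      infDist (meshPoint δ x) (D.arc j) ≤ infDist (meshPoint δ x) (D.arc (j + 1))) :
    infDist (meshPoint δ x) (D.arc j) ≤ 6 * δ := by
  rcases h with ⟨i, hi⟩ | h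
  · exact (infDist_le_dist_of_mem (D.pt_mem_arc i j)).trans hi.le
  · have hfne : (frontier D.carrier).Nonempty := ⟨_, D.pt_mem_frontier 0⟩
    obtain ⟨q, hq, hqd⟩ := isClosed_frontier.exists_infDist_eq_dist hfne (meshPoint δ x)
    have h2 : dist (meshPoint δ x) q ≤ 2 * δ := hqd ▸ infDist_frontier_le' D hδ hx
    have hq' : q ∈ D.arc j ∨ q ∈ D.arc (j + 1) := by
      have := (mem_frontier_iff_mem_arc D q).1 hq
      fin_cases j
      · simpa using this
      · simpa [show (1 : Fin 2) + 1 = 0 from rfl, or_comm] using this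
    rcases hq' with hq' | hq'
    · linarith [infDist_le_dist_of_mem (x := meshPoint δ x) hq']
    · linarith [infDist_le_dist_of_mem (x := meshPoint δ x) hq']

section Package

variable (D : DobrushinDomain) {δ R c₀ : ℝ} (A : Site 2 → Prop) (C : Fin 2 → Site 2 → Prop)
  (z : Fin 2 → Fin 2 → Site 2)
  (hδ : 0 < δ) (hδR : 128 * δ ≤ R) (hR01 : R ≤ dist (D.pt 0) (D.pt 1))
  (hgap : ∀ j : Fin 2, ∀ w ∈ D.arc j, R / 32 ≤ dist w (D.pt 0) → R / 32 ≤ dist w (D.pt 1) →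
    c₀ ≤ infDist w (D.arc (j + 1))) (hc₀ : 8 * δ < c₀)
  (hAvor : ∀ x, 6 * δ ≤ dist (meshPoint δ x) (D.pt 0) → 6 * δ ≤ dist (meshPoint δ x) (D.pt 1) →
    (A x ↔ infDist (meshPoint δ x) (D.arc 0) ≤ infDist (meshPoint δ x) (D.arc 1)))
  (hAC : ∀ i : Fin 2, ∀ x ∈ (⟨D.carrier, δ, ∅, ∅⟩ : DiscreteDobrushin).zdBoundary,
    dist (meshPoint δ x) (D.pt i) < R / 4 - 2 * δ → (A x ↔ C i x))
  (hCC : ∀ i : Fin 2, ∀ x ∈ (⟨D.carrier, δ, ∅, ∅⟩ : DiscreteDobrushin).zdBoundary,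
    ∀ y ∈ (⟨D.carrier, δ, ∅, ∅⟩ : DiscreteDobrushin).zdBoundary,
    dist (meshPoint δ x) (D.pt i) < R / 4 - 2 * δ → dist (meshPoint δ y) (D.pt i) < R / 4 - 2 * δ →
    ∀ q ∈ frontier D.carrier, dist (meshPoint δ x) q = infDist (meshPoint δ x) (frontier D.carrier) →
    dist (meshPoint δ y) q = infDist (meshPoint δ y) (frontier D.carrier) → (C i x ↔ C i y))
  (hz : ∀ i : Fin 2, z i 0 ∈ (⟨D.carrier, δ, ∅, ∅⟩ : DiscreteDobrushin).zdBoundary ∧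
    z i 1 ∈ (⟨D.carrier, δ, ∅, ∅⟩ : DiscreteDobrushin).zdBoundary ∧
    (discreteDomainGraph D.carrier δ).Adj (z i 0) (z i 1) ∧
    dist (meshPoint δ (z i 0)) (D.pt i) ≤ 5 * δ ∧ dist (meshPoint δ (z i 1)) (D.pt i) ≤ 5 * δ ∧
    ¬ (C i (z i 0) ↔ C i (z i 1)))
  (hzu : ∀ i : Fin 2, ∀ x y, (discreteDomainGraph D.carrier δ).Adj x y →
    x ∈ (⟨D.carrier, δ, ∅, ∅⟩ : DiscreteDobrushin).zdBoundary →
    y ∈ (⟨D.carrier, δ, ∅, ∅⟩ : DiscreteDobrushin).zdBoundary →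
    dist (meshPoint δ x) (D.pt i) < R / 4 - 4 * δ → ¬ (C i x ↔ C i y) → s(x, y) = s(z i 0, z i 1))
  (hzf : ∀ i : Fin 2, ∃! f, (⟨D.carrier, δ, ∅, ∅⟩ : DiscreteDobrushin).IsInnerFace f ∧
    ∀ x ∈ s(z i 0, z i 1), LatticeModels.IsCorner x f)

include hδ hδR hR01 hgap hc₀ hAvor hAC hCC hz hzu hzf in
/-- **The labelling package at mesh `δ`.** [folklore] -/
theorem package_at_mesh :
    {x | x ∈ (⟨D.carrier, δ, ∅, ∅⟩ : DiscreteDobrushin).zdBoundary ∧ A x} ∪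
        {x | x ∈ (⟨D.carrier, δ, ∅, ∅⟩ : DiscreteDobrushin).zdBoundary ∧ ¬ A x} =
        (⟨D.carrier, δ, ∅, ∅⟩ : DiscreteDobrushin).zdBoundary ∧
      Disjoint {x | x ∈ (⟨D.carrier, δ, ∅, ∅⟩ : DiscreteDobrushin).zdBoundary ∧ A x}
        {x | x ∈ (⟨D.carrier, δ, ∅, ∅⟩ : DiscreteDobrushin).zdBoundary ∧ ¬ A x} ∧
      {x | x ∈ (⟨D.carrier, δ, ∅, ∅⟩ : DiscreteDobrushin).zdBoundary ∧ A x}.Nonempty ∧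
      {x | x ∈ (⟨D.carrier, δ, ∅, ∅⟩ : DiscreteDobrushin).zdBoundary ∧ ¬ A x}.Nonempty ∧
      (∀ y ∈ {x | x ∈ (⟨D.carrier, δ, ∅, ∅⟩ : DiscreteDobrushin).zdBoundary ∧ A x},
        ¬ closedBall (meshPoint δ y) (infDist (meshPoint δ y) (frontier D.carrier)) ⊆
          ⋃ x ∈ {x | x ∈ (⟨D.carrier, δ, ∅, ∅⟩ : DiscreteDobrushin).zdBoundary ∧ ¬ A x},
            closedBall (meshPoint δ x) (infDist (meshPoint δ x) (frontier D.carrier))) ∧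
      (∀ x ∈ {x | x ∈ (⟨D.carrier, δ, ∅, ∅⟩ : DiscreteDobrushin).zdBoundary ∧ ¬ A x},
        ¬ closedBall (meshPoint δ x) (infDist (meshPoint δ x) (frontier D.carrier)) ⊆
          ⋃ y ∈ {x | x ∈ (⟨D.carrier, δ, ∅, ∅⟩ : DiscreteDobrushin).zdBoundary ∧ A x},
            closedBall (meshPoint δ y) (infDist (meshPoint δ y) (frontier D.carrier))) ∧
      (∀ y ∈ {x | x ∈ (⟨D.carrier, δ, ∅, ∅⟩ : DiscreteDobrushin).zdBoundary ∧ A x},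
        infDist (meshPoint δ y) (D.arc 0) ≤ 6 * δ) ∧
      (∀ x ∈ {x | x ∈ (⟨D.carrier, δ, ∅, ∅⟩ : DiscreteDobrushin).zdBoundary ∧ ¬ A x},
        infDist (meshPoint δ x) (D.arc 1) ≤ 6 * δ) ∧
      {e | e ∈ (discreteDomainGraph D.carrier δ).edgeSet ∧
        (∃ x ∈ e, x ∈ {x | x ∈ (⟨D.carrier, δ, ∅, ∅⟩ : DiscreteDobrushin).zdBoundary ∧ A x}) ∧
        ∃ y ∈ e, y ∈ {x | x ∈ (⟨D.carrier, δ, ∅, ∅⟩ : DiscreteDobrushin).zdBoundary ∧ ¬ A x}}.ncard = 2 ∧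
      (∀ e ∈ (discreteDomainGraph D.carrier δ).edgeSet,
        (∃ x ∈ e, x ∈ {x | x ∈ (⟨D.carrier, δ, ∅, ∅⟩ : DiscreteDobrushin).zdBoundary ∧ A x}) →
        (∃ y ∈ e, y ∈ {x | x ∈ (⟨D.carrier, δ, ∅, ∅⟩ : DiscreteDobrushin).zdBoundary ∧ ¬ A x}) →
        ∃! f, (⟨D.carrier, δ, ∅, ∅⟩ : DiscreteDobrushin).IsInnerFace f ∧ ∀ x ∈ e, LatticeModels.IsCorner x f) ∧
      {e | e ∈ (discreteDomainGraph D.carrier δ).edgeSet ∧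
        (∃ x ∈ e, x ∈ {x | x ∈ (⟨D.carrier, δ, ∅, ∅⟩ : DiscreteDobrushin).zdBoundary ∧ A x}) ∧
        ∃ y ∈ e, y ∈ {x | x ∈ (⟨D.carrier, δ, ∅, ∅⟩ : DiscreteDobrushin).zdBoundary ∧ ¬ A x}} =
        {s(z 0 0, z 0 1), s(z 1 0, z 1 1)} ∧
      hausdorffEDist (medialPoint δ '' {s(z 0 0, z 0 1), s(z 1 0, z 1 1)}) {D.pt 0, D.pt 1} ≤
        ENNReal.ofReal (5 * δ) := by
  classical
  have hcross := crossing_eq D A C z hδ hδR hgap hc₀ hAvor hAC hz hzu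
  have hne := cut_edges_ne D C z hδ hδR hR01 hz
  -- both labels occur at the cut edge of mark `0`
  obtain ⟨h0, h1, -, hd0, hd1, hC⟩ := hz 0
  have hA0 := hAC 0 _ h0 (by linarith)
  have hA1 := hAC 0 _ h1 (by linarith)
  have hboth : ∃ a b, a ∈ (⟨D.carrier, δ, ∅, ∅⟩ : DiscreteDobrushin).zdBoundary ∧ A a ∧
      b ∈ (⟨D.carrier, δ, ∅, ∅⟩ : DiscreteDobrushin).zdBoundary ∧ ¬ A b := by
    by_cases hAz : A (z 0 0)
    · exact ⟨_, _, h0, hAz, h1, fun hAz' => hC ⟨fun _ => hA1.1 hAz', fun _ => hA0.1 hAz⟩⟩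
    · refine ⟨_, _, h1, ?_, h0, hAz⟩
      by_contra hAz'
      exact hC ⟨fun h => absurd (hA0.2 h) hAz, fun h => absurd (hA1.2 h) hAz'⟩
  obtain ⟨a, b, ha, hAa, hb, hAb⟩ := hboth
  refine ⟨?_, ?_, ⟨a, ha, hAa⟩, ⟨b, hb, hAb⟩, ?_, ?_, ?_, ?_, ?_, ?_, hcross,
    hausdorffEDist_medialPoint_le D C z hz⟩
  · ext x
    simp only [mem_union, mem_setOf_eq]
    refine ⟨fun h => h.elim And.left And.left, fun h => ?_⟩
    by_cases hA : A x
    exacts [Or.inl ⟨h, hA⟩, Or.inr ⟨h, hA⟩]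
  · exact Set.disjoint_left.2 fun x hx hx' => hx'.2 hx.2
  · rintro y ⟨hy, hAy⟩
    exact not_covered D A C hδ hδR hgap hc₀ hAvor hAC hCC hy (fun x hx => hx.1) fun x hx h => hx.2 (h.2 hAy)
  · rintro x ⟨hx, hAx⟩
    exact not_covered D A C hδ hδR hgap hc₀ hAvor hAC hCC hx (fun y hy => hy.1) fun y hy h => hAx (h.1 hy.2)
  · rintro y ⟨hy, hAy⟩
    refine infDist_arc_le_of_label D hδ hy 0 ?_
    by_cases hn : ∃ i : Fin 2, dist (meshPoint δ y) (D.pt i) < 6 * δ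
    · exact Or.inl hn
    · push Not at hn
      exact Or.inr (by simpa using (hAvor y (hn 0) (hn 1)).1 hAy)
  · rintro x ⟨hx, hAx⟩
    refine infDist_arc_le_of_label D hδ hx 1 ?_
    by_cases hn : ∃ i : Fin 2, dist (meshPoint δ x) (D.pt i) < 6 * δ
    · exact Or.inl hn
    · push Not at hn
      rw [hAvor x (hn 0) (hn 1), not_le] at hAx
      exact Or.inr (by simpa [show (1 : Fin 2) + 1 = 0 from rfl] using hAx.le)
  · rw [hcross]; exact ncard_pair hne
  · intro e he hxA hyB
    have : e ∈ {e | e ∈ (discreteDomainGraph D.carrier δ).edgeSet ∧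
        (∃ x ∈ e, x ∈ {x | x ∈ (⟨D.carrier, δ, ∅, ∅⟩ : DiscreteDobrushin).zdBoundary ∧ A x}) ∧
        ∃ y ∈ e, y ∈ {x | x ∈ (⟨D.carrier, δ, ∅, ∅⟩ : DiscreteDobrushin).zdBoundary ∧ ¬ A x}} :=
      ⟨he, hxA, hyB⟩
    rw [hcross] at this
    rcases this with rfl | rfl
    · exact hzf 0
    · exact hzf 1

end Package

end SmoothMark

/-! ### Registered sub-goal (one-line signature, verbatim) -/

/-- **Registered sub-goal `smoothMark_part10` of `stub_smoothMarkFamilies`**: sides: labelled boundary sites are within `6δ` of their arc. [folklore] -/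
theorem smoothMark_part10 : ∀ (D : DobrushinDomain) (δ : ℝ), 0 < δ → ∀ x : Site 2, x ∈ (⟨D.carrier, δ, ∅, ∅⟩ : DiscreteDobrushin).zdBoundary → ∀ j : Fin 2, ((∃ i : Fin 2, dist (meshPoint δ x) (D.pt i) < 6 * δ) ∨ Metric.infDist (meshPoint δ x) (D.arc j) ≤ Metric.infDist (meshPoint δ x) (D.arc (j + 1))) → Metric.infDist (meshPoint δ x) (D.arc j) ≤ 6 * δ :=
  fun D _ hδ _ hx j h => SmoothMark.infDist_arc_le_of_label D hδ hx j h

end Summit.CriticalPhenomena.CardyFormulaZ2.Cruxes.SLESixFamiliesGiveCardy.CollarTouchSandwich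

end
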